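import Literature.Combinatorics.StablePolynomials.ProperPosition
import HarnessLib

/-!
# Linear spaces of stable polynomials: dimension at most two (real case) and one (complex case)
# (Borcea–Brändén 2009, Lemma 3.2)

Topic `Literature/Combinatorics/StablePolynomials`, namespace `Literature.Combinatorics.StablePolynomials`; companion
of `ProperPosition.lean` (Definition 1.1 `IsProperPosition`, the multivariate Hermite–Kakeya–Obreschkoff theorem
`isRealStable_pencil_iff`, the half-plane characterisation `isProperPosition_iff`, Corollary 1.10
`IsProperPosition.exists_eq_C_mul`); lane `lit-hodgefound` (Track 2 foundations library), seat p16, generation 31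
(row g31-#9).

## Source (verbatim) — J. Borcea, P. Brändén, *The Lee–Yang and Pólya–Schur programs. I. Linear operators
## preserving stability*, Invent. Math. 177 (2009) 541–569 [BorceaBranden2009] (held: `paper:arxiv-0809.0401`,
## p. 10 of the arXiv text)

**Lemma 3.2.** "Let `V ⊆ 𝕂[z₁,…,zₙ]` be a `𝕂`-linear space, where `𝕂 = ℝ` or `ℂ`. (i) If `𝕂 = ℝ` and every
non-zero element of `V` is real stable then `dim V ≤ 2`. (ii) If `𝕂 = ℂ` and every non-zero element of `V` is
stable then `dim V ≤ 1`." Proof of (i): "Suppose that there are three linearly independent polynomials `f₁, f₂`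
and `f₃` in `V`. By the multivariate Hermite–Kakeya–Obreschkoff theorem (Theorem 1.9) and the assumption on `V`
these polynomials are mutually in proper position. Without loss of generality we may assume that `f₁ ≪ f₂` and
`f₁ ≫ f₃`. Now consider the line segment in `V` given by `ℓ_θ = θf₃ + (1−θ)f₂`, `0 ≤ θ ≤ 1`, and note in
particular that for any such `θ` one has either `f₁ ≪ ℓ_θ` or `f₁ ≫ ℓ_θ`. Set `η = sup{θ ∈ [0,1] : f₁ ≪ ℓ_θ}`.
Since `f₁ ≪ ℓ₀` and `f₁ ≫ ℓ₁` it follows from Hurwitz' theorem (Theorem 1.6) that `f₁ ≪ ℓ_η` and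
`f₁ ≫ ℓ_η`. This means that `f₁` and `ℓ_η` are constant multiples of each other (cf. Corollary 1.10), contrary
to the assumption that `f₁, f₂` and `f₃` are linearly independent."

## What is here

* `isProperPosition_or_of_forall_mem` — in such a space any two elements `u, v` satisfy `u = v = 0`, `u ≪ v` or
  `v ≪ u` (Theorem 1.9);
* **`not_linearIndependent_of_forall_mem`** — Lemma 3.2 (i) in the three-element form: no three elements of `V`
  are linearly independent;
* **`rank_le_two_of_forall_mem`** — Lemma 3.2 (i): `Module.rank ℝ V ≤ 2`;
* `exists_eq_smul_of_forall_mem`, **`rank_le_one_of_forall_mem`** — Lemma 3.2 (ii): a complex linear space of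
  stable-or-zero polynomials has `Module.rank ℂ V ≤ 1` (every element is a multiple of any nonzero one).

## Proof route and the one deviation

The printed proof, except that the closedness of `{θ ∈ [0,1] : f₁ ≪ ℓ_θ}` and of `{θ : ℓ_θ ≪ f₁}` — obtained in
print from Hurwitz' theorem — is read off the half-plane characterisation `isProperPosition_iff` of
`ProperPosition.lean`: given that `f₁` and every `ℓ_θ` are real stable or zero and not both zero, `f₁ ≪ ℓ_θ` iff
`Im (f₁(z) · conj ℓ_θ(z)) ≤ 0` for all `z ∈ ℋⁿ`, a closed condition in `θ`; the supremum `η` is replaced by the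
connectedness of `[0,1]` (`isPreconnected_closed_iff`). The "without loss of generality" is realised by the sign
changes `f₂ ↦ ±f₂`, `f₃ ↦ ±f₃` (`IsProperPosition.swap_neg`). Part (ii) is proved directly (not through (i) and
Wronskians as printed): `g − (g(z₀)/f(z₀)) f ∈ V` vanishes at a point `z₀ ∈ ℋⁿ`, hence is `0`.

## References

* [BorceaBranden2009] J. Borcea, P. Brändén, *The Lee–Yang and Pólya–Schur programs. I. Linear operators
  preserving stability*, Invent. Math. 177 (2009) 541–569, arXiv:0809.0401 — §3 Lemma 3.2 and its proof;
  §1 Theorem 1.9, Corollary 1.10.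
-/

noncomputable section

open scoped BigOperators Topology ComplexConjugate
open MvPolynomial Filter Set

namespace Literature.Combinatorics.StablePolynomials

variable {σ : Type*}

section Dimension

variable [Fintype σ]

/-- In a real linear space of real-stable-or-zero polynomials any two elements `u, v` satisfy `u = v = 0`,
`u ≪ v` or `v ≪ u` (Theorem 1.9). [cite: BorceaBranden2009, §3 proof of Lemma 3.2 (i) ("these polynomials are
mutually in proper position")] -/
theorem isProperPosition_or_of_forall_mem {V : Submodule ℝ (MvPolynomial σ ℝ)}
    (hV : ∀ p ∈ V, p = 0 ∨ IsRealStable p) {u v : MvPolynomial σ ℝ} (hu : u ∈ V) (hv : v ∈ V) :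
    (u = 0 ∧ v = 0) ∨ IsProperPosition u v ∨ IsProperPosition v u :=
  (isRealStable_pencil_iff u v).1 fun a b => hV _ (by
    rw [← smul_eq_C_mul, ← smul_eq_C_mul]
    exact V.add_mem (V.smul_mem a hu) (V.smul_mem b hv))

/-- **Lemma 3.2 (i), three-element form**: in a real linear space `V ⊆ ℝ[z₁,…,zₙ]` all of whose nonzero
elements are real stable, any three elements are linearly dependent. (Printed proof, with the closedness of
`{θ : f₁ ≪ ℓ_θ}` taken from the half-plane characterisation `isProperPosition_iff` — the condition
`Im (f₁ · conj ℓ_θ) ≤ 0` on `ℋⁿ` is closed in `θ` — instead of Hurwitz' theorem: after sign changes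
`f₁ ≪ ±f₂ = ℓ₀` and `ℓ₁ = ±f₃ ≪ f₁`; every `ℓ_θ = θℓ₁ + (1−θ)ℓ₀` is nonzero and comparable with `f₁`; by
connectedness of `[0,1]` some `ℓ_η` satisfies both `f₁ ≪ ℓ_η` and `ℓ_η ≪ f₁`, so `f₁ = aℓ_η` by Corollary 1.10.)
[cite: BorceaBranden2009, §3 Lemma 3.2 (i) and its proof] -/
theorem not_linearIndependent_of_forall_mem {V : Submodule ℝ (MvPolynomial σ ℝ)}
    (hV : ∀ p ∈ V, p = 0 ∨ IsRealStable p) {f : Fin 3 → MvPolynomial σ ℝ} (hf : ∀ i, f i ∈ V) :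
    ¬LinearIndependent ℝ f := by
  intro hlin
  have hcomb : ∀ a b c : ℝ, a • f 0 + b • f 1 + c • f 2 = 0 → a = 0 ∧ b = 0 ∧ c = 0 := by
    intro a b c h0
    have key := Fintype.linearIndependent_iff.1 hlin ![a, b, c] (by simpa [Fin.sum_univ_three] using h0)
    exact ⟨by simpa using key 0, by simpa using key 1, by simpa using key 2⟩
  have hf0 : f 0 ≠ 0 := fun h0 => by
    have := (hcomb 1 0 0 (by simp [h0])).1
    norm_num at this
  have hf₁st : f 0 = 0 ∨ IsRealStable (f 0) := hV _ (hf 0)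
  -- Step 1: `f 0 ≪ s₂ f 1` and `s₃ f 2 ≪ f 0` for signs `s₂, s₃ = ±1`
  obtain ⟨s₂, hs₂, hg₂⟩ : ∃ s : ℝ, (s = 1 ∨ s = -1) ∧ IsProperPosition (f 0) (s • f 1) := by
    rcases isProperPosition_or_of_forall_mem hV (hf 0) (hf 1) with ⟨h0, -⟩ | h | h
    · exact absurd h0 hf0
    · exact ⟨1, Or.inl rfl, by rwa [one_smul]⟩
    · exact ⟨-1, Or.inr rfl, by rw [neg_one_smul]; exact h.swap_neg⟩
  obtain ⟨s₃, hs₃, hg₃⟩ : ∃ s : ℝ, (s = 1 ∨ s = -1) ∧ IsProperPosition (s • f 2) (f 0) := by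
    rcases isProperPosition_or_of_forall_mem hV (hf 0) (hf 2) with ⟨h0, -⟩ | h | h
    · exact absurd h0 hf0
    · refine ⟨-1, Or.inr rfl, ?_⟩
      rw [neg_one_smul]
      simpa using h.swap_neg.swap_neg.swap_neg
    · exact ⟨1, Or.inl rfl, by rwa [one_smul]⟩
  have hs₂0 : s₂ ≠ 0 := by rcases hs₂ with rfl | rfl <;> norm_num
  have hs₃0 : s₃ ≠ 0 := by rcases hs₃ with rfl | rfl <;> norm_num
  -- Step 2: the segment `ℓ θ = θ (s₃ f 2) + (1 - θ) (s₂ f 1)` consists of nonzero elements of `V`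
  set ℓ : ℝ → MvPolynomial σ ℝ := fun θ => θ • (s₃ • f 2) + (1 - θ) • (s₂ • f 1) with hℓ
  have hℓmem : ∀ θ, ℓ θ ∈ V := fun θ =>
    V.add_mem (V.smul_mem _ (V.smul_mem _ (hf 2))) (V.smul_mem _ (V.smul_mem _ (hf 1)))
  have hℓne : ∀ θ ∈ Icc (0 : ℝ) 1, ℓ θ ≠ 0 := by
    intro θ hθ h0
    have key := hcomb 0 ((1 - θ) * s₂) (θ * s₃) (by
      rw [zero_smul, zero_add, mul_smul, mul_smul, add_comm]
      simpa [hℓ] using h0)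
    rcases mul_eq_zero.1 key.2.1 with hb | hb
    · rcases mul_eq_zero.1 key.2.2 with hc | hc
      · linarith
      · exact hs₃0 hc
    · exact hs₂0 hb
  have hcomp : ∀ θ : ℝ, IsProperPosition (f 0) (ℓ θ) ∨ IsProperPosition (ℓ θ) (f 0) := by
    intro θ
    rcases isProperPosition_or_of_forall_mem hV (hf 0) (hℓmem θ) with ⟨h0, -⟩ | h | h
    · exact absurd h0 hf0
    · exact Or.inl h
    · exact Or.inr h
  -- Step 3: the closed sets `A = {θ : Im (f₀ conj ℓ_θ) ≤ 0 on ℋⁿ}`, `B = {θ : Im (ℓ_θ conj f₀) ≤ 0 on ℋⁿ}`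
  have hLeval : ∀ (θ : ℝ) (z : σ → ℂ), eval z (map (algebraMap ℝ ℂ) (ℓ θ)) =
      (θ : ℂ) * ((s₃ : ℂ) * eval z (map (algebraMap ℝ ℂ) (f 2))) +
        ((1 - θ : ℝ) : ℂ) * ((s₂ : ℂ) * eval z (map (algebraMap ℝ ℂ) (f 1))) := by
    intro θ z
    simp only [hℓ, smul_eq_C_mul, map_add, map_mul, map_C, eval_C, Complex.coe_algebraMap]
  set Φ : (σ → ℂ) → ℝ → ℝ := fun z θ =>
    (eval z (map (algebraMap ℝ ℂ) (f 0)) * conj (eval z (map (algebraMap ℝ ℂ) (ℓ θ)))).im with hΦ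
  set Ψ : (σ → ℂ) → ℝ → ℝ := fun z θ =>
    (eval z (map (algebraMap ℝ ℂ) (ℓ θ)) * conj (eval z (map (algebraMap ℝ ℂ) (f 0)))).im with hΨ
  have hΦc : ∀ z, Continuous (Φ z) := fun z => by
    simp only [hΦ, hLeval]
    fun_prop
  have hΨc : ∀ z, Continuous (Ψ z) := fun z => by
    simp only [hΨ, hLeval]
    fun_prop
  set A : Set ℝ := ⋂ z : σ → ℂ, ⋂ (_ : ∀ i, 0 < (z i).im), {θ : ℝ | Φ z θ ≤ 0} with hA
  set B : Set ℝ := ⋂ z : σ → ℂ, ⋂ (_ : ∀ i, 0 < (z i).im), {θ : ℝ | Ψ z θ ≤ 0} with hB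
  have hAc : IsClosed A :=
    isClosed_iInter fun z => isClosed_iInter fun _ => isClosed_le (hΦc z) continuous_const
  have hBc : IsClosed B :=
    isClosed_iInter fun z => isClosed_iInter fun _ => isClosed_le (hΨc z) continuous_const
  have hmemA : ∀ θ, θ ∈ A ↔ ∀ z : σ → ℂ, (∀ i, 0 < (z i).im) → Φ z θ ≤ 0 := fun θ => by
    simp only [hA, mem_iInter, mem_setOf_eq]
  have hmemB : ∀ θ, θ ∈ B ↔ ∀ z : σ → ℂ, (∀ i, 0 < (z i).im) → Ψ z θ ≤ 0 := fun θ => by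
    simp only [hB, mem_iInter, mem_setOf_eq]
  have hAiff : ∀ θ : ℝ, IsProperPosition (f 0) (ℓ θ) ↔ θ ∈ A := fun θ => by
    rw [hmemA, isProperPosition_iff]
    exact ⟨fun h => h.2.2.2, fun h => ⟨hf₁st, hV _ (hℓmem θ), fun h0 => hf0 h0.1, h⟩⟩
  have hBiff : ∀ θ : ℝ, IsProperPosition (ℓ θ) (f 0) ↔ θ ∈ B := fun θ => by
    rw [hmemB, isProperPosition_iff]
    exact ⟨fun h => h.2.2.2, fun h => ⟨hV _ (hℓmem θ), hf₁st, fun h0 => hf0 h0.2, h⟩⟩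
  -- Step 4: connectedness of `[0, 1]`
  have hcover : Icc (0 : ℝ) 1 ⊆ A ∪ B := fun θ _ => (hcomp θ).imp (hAiff θ).1 (hBiff θ).1
  have h0A : (Icc (0 : ℝ) 1 ∩ A).Nonempty :=
    ⟨0, ⟨le_rfl, zero_le_one⟩, (hAiff 0).1 (by simpa [hℓ] using hg₂)⟩
  have h1B : (Icc (0 : ℝ) 1 ∩ B).Nonempty :=
    ⟨1, ⟨zero_le_one, le_rfl⟩, (hBiff 1).1 (by simpa [hℓ] using hg₃)⟩
  obtain ⟨η, hη, hηA, hηB⟩ := isPreconnected_closed_iff.1 isPreconnected_Icc A B hAc hBc hcover h0A h1B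
  -- Step 5: `f 0 ≪ ℓ η ≪ f 0` forces `f 0 = a ℓ η`, contradicting linear independence
  obtain ⟨a, ha⟩ := ((hAiff η).2 hηA).exists_eq_C_mul ((hBiff η).2 hηB) (hℓne η hη)
  have key := hcomb 1 (-(a * ((1 - η) * s₂))) (-(a * (η * s₃))) (by
    rw [ha]
    simp only [hℓ, smul_eq_C_mul, map_neg, map_mul, map_sub, map_one]
    ring)
  norm_num at key

/-- **Lemma 3.2 (i).** If every nonzero element of a real linear space `V ⊆ ℝ[z₁,…,zₙ]` is real stable, then
`dim V ≤ 2`. [cite: BorceaBranden2009, §3 Lemma 3.2 (i)] -/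
theorem rank_le_two_of_forall_mem (V : Submodule ℝ (MvPolynomial σ ℝ))
    (hV : ∀ p ∈ V, p = 0 ∨ IsRealStable p) : Module.rank ℝ V ≤ 2 := by
  suffices h : Module.rank ℝ V ≤ (2 : ℕ) by exact_mod_cast h
  refine rank_le fun s hs => ?_
  by_contra hlt
  push Not at hlt
  obtain ⟨t, hts, htcard⟩ := Finset.exists_subset_card_eq (Nat.succ_le_of_lt hlt)
  have hst : LinearIndependent ℝ fun i : t => ((i : V) : MvPolynomial σ ℝ) := by
    have h1 : LinearIndependent ℝ fun i : t => (i : V) :=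
      hs.comp (Set.inclusion (Finset.coe_subset.2 hts)) (Set.inclusion_injective _)
    exact h1.map' V.subtype (Submodule.ker_subtype V)
  have e : t ≃ Fin 3 := Finset.equivFinOfCardEq htcard
  have h3 : LinearIndependent ℝ fun i : Fin 3 => (((e.symm i : t) : V) : MvPolynomial σ ℝ) :=
    hst.comp e.symm e.symm.injective
  exact not_linearIndependent_of_forall_mem hV (fun i => ((e.symm i : t) : V).2) h3

end Dimension

/-! ## Lemma 3.2 (ii): complex linear spaces of stable polynomials are at most one-dimensional -/

section ComplexDimension

/-- **Lemma 3.2 (ii), two-element form**: in a complex linear space `V ⊆ ℂ[z₁,…,zₙ]` all of whose nonzero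
elements are stable, every element is a complex multiple of any nonzero element: for `f ≠ 0` in `V` and
`z₀ ∈ ℋⁿ` one has `f(z₀) ≠ 0`, and `g − (g(z₀)/f(z₀)) f ∈ V` vanishes at `z₀`, so it is the zero polynomial. (The
printed proof reduces to part (i) and a Wronskian computation; this one-line argument is the one used for the
operator form `exists_functional_of_image_stable` in `BasicProofs.lean`.)
[cite: BorceaBranden2009, §3 Lemma 3.2 (ii)] -/
theorem exists_eq_smul_of_forall_mem {V : Submodule ℂ (MvPolynomial σ ℂ)}
    (hV : ∀ p ∈ V, p = 0 ∨ IsUpperHalfPlaneStable p) {f g : MvPolynomial σ ℂ} (hf : f ∈ V) (hg : g ∈ V)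
    (hf0 : f ≠ 0) : ∃ c : ℂ, g = c • f := by
  have hfs : IsUpperHalfPlaneStable f := (hV f hf).resolve_left hf0
  have hz₀ : ∀ i : σ, 0 < ((fun _ => Complex.I : σ → ℂ) i).im := fun _ => by simp
  have hfz : eval (fun _ => Complex.I) f ≠ 0 := hfs _ hz₀
  refine ⟨eval (fun _ => Complex.I) g / eval (fun _ => Complex.I) f, ?_⟩
  rcases hV _ (V.sub_mem hg (V.smul_mem (eval (fun _ => Complex.I) g / eval (fun _ => Complex.I) f) hf))
    with h0 | hst
  · exact sub_eq_zero.1 h0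
  · exfalso
    refine hst _ hz₀ ?_
    rw [map_sub, smul_eval, div_mul_cancel₀ _ hfz, sub_self]

/-- **Lemma 3.2 (ii).** If every nonzero element of a complex linear space `V ⊆ ℂ[z₁,…,zₙ]` is stable, then
`dim V ≤ 1`. [cite: BorceaBranden2009, §3 Lemma 3.2 (ii)] -/
theorem rank_le_one_of_forall_mem (V : Submodule ℂ (MvPolynomial σ ℂ))
    (hV : ∀ p ∈ V, p = 0 ∨ IsUpperHalfPlaneStable p) : Module.rank ℂ V ≤ 1 := by
  rw [rank_submodule_le_one_iff]
  by_cases hex : ∃ f ∈ V, f ≠ 0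
  · obtain ⟨f, hf, hf0⟩ := hex
    refine ⟨f, hf, fun g hg => ?_⟩
    obtain ⟨c, hc⟩ := exists_eq_smul_of_forall_mem hV hf hg hf0
    exact Submodule.mem_span_singleton.2 ⟨c, hc.symm⟩
  · push Not at hex
    refine ⟨0, V.zero_mem, fun g hg => ?_⟩
    rw [hex g hg]
    exact Submodule.zero_mem _

end ComplexDimension

end Literature.Combinatorics.StablePolynomials
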